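import Mathlib
import HarnessLib

/-!
# A small coprime companion polynomial (solo-Schanuel-blind, Lemma T of Proposition NG)

Proposition NG (`paper/nogo.md` of the solo-blind seat) says that no *profile-reading* criterion for
algebraic independence (one whose hypotheses are only degrees, heights, sizes at `θ`, number and
zero-freeness of the polynomials handed over) can complete Roy's programme toward Schanuel's
conjecture in rank `l ≥ 3`: its counterexample point `θ = (x₁, x₂, 1, …, 1)` uses two Liouville
numbers, and at each scale the family `{q X − p, T(X)}` where `p/q` is a convergent of `xᵢ` and `T`
is a **small coprime companion**: `T ∈ ℤ[X]`, `deg T ≤ D`, `T(p/q) = q^{-D}` (so `T` and `qX − p`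
are coprime and `T(p/q) ≠ 0`) and height `H(T) ≤ 3q/2 + 1` — the point being that the height does
NOT grow with `D`. This file proves the existence of `T` (as its coefficient vector) by an explicit
integer recursion, kernel-checking the arithmetic core of NG:

* `exists_centred_residue` — for `p` coprime to `q` there is `c₀` with `2|c₀| ≤ p` and
  `p ∣ M − c₀ q^n` (balanced residue of `M·(q^n)⁻¹ mod p`);
* `coprime_companion_aux` — for all `D, M` there is `c ∈ ℤ^{D+1}` with `Σ cᵢ pⁱ q^{D−i} = M`,
  `2|cᵢ| ≤ p` for `i < D`, and `|c_D| ≤ |M|/p^D + (q/2)·Σ_{j<D} (q/p)^j` (peel off `c₀`, divide by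
  `p`, recurse on `M₁ = (M − c₀q^D)/p`);
* `coprime_companion` — the closed form `|c_D| ≤ |M|/p^D + qp/(2(p−q))` for `q < p`;
* `coprime_companion_height` — for `3q < 2p < 4q` (i.e. `p/q ∈ (3/2, 2)`) and `M = 1`: all
  `2|cᵢ| ≤ 3q + 2`, i.e. `H(T) ≤ 3q/2 + 1`, together with `Σ cᵢ pⁱ q^{D−i} = 1`, which is
  `q^D · T(p/q) = 1` (`coprime_companion_eval`).

(The prose proof in `nogo.md` used Babai rounding against the relation lattice `⟨q e_{i+1} − p e_i⟩`;
the recursion here is its integer shadow. NG's Liouville points are taken in `(3/2, 2)`.)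

References: D. Roy, *An arithmetic criterion for the values of the exponential function*, Acta
Arith. 97 (2001) [Roy2001] (the programme NG constrains); the lemma itself is elementary.
-/

namespace Summit.Schanuel.Schanuel.Theorems

open Finset

/-- **Balanced residue.** If `p ≥ 1` is coprime to `q` then for every `n` and `M` there is an
integer `c₀` with `2|c₀| ≤ p` and `p ∣ M − c₀ q^n`. -/
theorem exists_centred_residue (p q : ℕ) (hp : 0 < p) (hcop : Nat.Coprime p q) (n : ℕ) (M : ℤ) :
    ∃ c₀ : ℤ, 2 * |c₀| ≤ (p : ℤ) ∧ (p : ℤ) ∣ M - c₀ * (q : ℤ) ^ n := by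
  have hc : IsCoprime (p : ℤ) ((q : ℤ) ^ n) := (Nat.isCoprime_iff_coprime.mpr hcop).pow_right
  obtain ⟨a, b, hab⟩ := hc
  refine ⟨Int.bmod (M * b) p, ?_, ?_⟩
  · have h1 := Int.le_bmod (x := M * b) hp
    have h2 := Int.bmod_le (x := M * b) hp
    rw [show (2 : ℤ) * |Int.bmod (M * b) p| = |2 * Int.bmod (M * b) p| by
      rw [abs_mul, abs_two], abs_le]
    constructor <;> omega
  · have hd : (p : ℤ) ∣ Int.bmod (M * b) p - M * b := Int.dvd_bmod_sub_self
    have e : M - Int.bmod (M * b) p * (q : ℤ) ^ n =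
        M * a * p - (Int.bmod (M * b) p - M * b) * (q : ℤ) ^ n := by
      linear_combination (-M) * hab
    rw [e]
    exact dvd_sub (dvd_mul_left _ _) (hd.mul_right _)

/-- **The recursion.** For coprime `0 < q < p` and all `D`, `M`: a vector `c ∈ ℤ^{D+1}` with
`Σ cᵢ pⁱ q^{D−i} = M`, `2|cᵢ| ≤ p` for `i < D`, and
`|c_D| ≤ |M|/p^D + (q/2)·Σ_{j<D} (q/p)^j`. -/
theorem coprime_companion_aux (p q : ℕ) (hq : 0 < q) (hqp : q < p) (hcop : Nat.Coprime p q) :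
    ∀ (D : ℕ) (M : ℤ), ∃ c : Fin (D + 1) → ℤ,
      (∑ i, c i * (p : ℤ) ^ (i : ℕ) * (q : ℤ) ^ (D - i) = M) ∧
      (∀ i : Fin (D + 1), (i : ℕ) < D → 2 * |c i| ≤ (p : ℤ)) ∧
      |(c (Fin.last D) : ℝ)| ≤
        |(M : ℝ)| / (p : ℝ) ^ D + (q : ℝ) / 2 * ∑ j ∈ range D, ((q : ℝ) / p) ^ j
  | 0, M => ⟨fun _ => M, by simp, fun i hi => absurd hi (Nat.not_lt_zero _), by simp⟩
  | D + 1, M => by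
    have hp : 0 < p := lt_trans hq hqp
    obtain ⟨c₀, hc₀, M₁, hM₁⟩ := exists_centred_residue p q hp hcop (D + 1) M
    obtain ⟨c', hsum, hbnd, hlast⟩ := coprime_companion_aux p q hq hqp hcop D M₁
    refine ⟨Fin.cons c₀ c', ?_, ?_, ?_⟩
    · rw [Fin.sum_univ_succ]
      simp only [Fin.cons_zero, Fin.cons_succ, Fin.val_zero, pow_zero, mul_one, Nat.sub_zero,
        Fin.val_succ]
      have e : ∀ i : Fin (D + 1), c' i * (p : ℤ) ^ ((i : ℕ) + 1) * (q : ℤ) ^ (D + 1 - ((i : ℕ) + 1))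
          = (p : ℤ) * (c' i * (p : ℤ) ^ (i : ℕ) * (q : ℤ) ^ (D - i)) := by
        intro i
        rw [Nat.add_sub_add_right, pow_succ]
        ring
      rw [Finset.sum_congr rfl (fun i _ => e i), ← Finset.mul_sum, hsum]
      linarith [hM₁]
    · intro i hi
      induction i using Fin.cases with
      | zero => simpa using hc₀
      | succ j =>
        simp only [Fin.cons_succ]
        exact hbnd j (by simpa using hi)
    · have elast : (Fin.cons c₀ c' : Fin (D + 2) → ℤ) (Fin.last (D + 1)) = c' (Fin.last D) := by
        rw [← Fin.succ_last, Fin.cons_succ]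
      rw [elast]
      have hpR : (0 : ℝ) < p := by exact_mod_cast hp
      have hc₀R : |(c₀ : ℝ)| ≤ (p : ℝ) / 2 := by
        have : (2 : ℝ) * |(c₀ : ℝ)| ≤ p := by exact_mod_cast hc₀
        linarith
      have hM₁Z : (M₁ : ℤ) * p = M - c₀ * (q : ℤ) ^ (D + 1) := by linarith [hM₁]
      have hM₁R : (M₁ : ℝ) = ((M : ℝ) - c₀ * (q : ℝ) ^ (D + 1)) / p := by
        rw [eq_div_iff hpR.ne']
        exact_mod_cast hM₁Z
      have habsM₁ : |(M₁ : ℝ)| ≤ (|(M : ℝ)| + (p : ℝ) / 2 * (q : ℝ) ^ (D + 1)) / p := by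
        rw [hM₁R, abs_div, abs_of_pos hpR]
        apply div_le_div_of_nonneg_right _ hpR.le
        calc |(M : ℝ) - c₀ * (q : ℝ) ^ (D + 1)|
            ≤ |(M : ℝ)| + |(c₀ : ℝ) * (q : ℝ) ^ (D + 1)| := abs_sub _ _
          _ = |(M : ℝ)| + |(c₀ : ℝ)| * (q : ℝ) ^ (D + 1) := by
              rw [abs_mul, abs_of_nonneg (by positivity : (0 : ℝ) ≤ (q : ℝ) ^ (D + 1))]
          _ ≤ |(M : ℝ)| + (p : ℝ) / 2 * (q : ℝ) ^ (D + 1) := by gcongr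
      calc |(c' (Fin.last D) : ℝ)|
          ≤ |(M₁ : ℝ)| / (p : ℝ) ^ D + (q : ℝ) / 2 * ∑ j ∈ range D, ((q : ℝ) / p) ^ j := hlast
        _ ≤ ((|(M : ℝ)| + (p : ℝ) / 2 * (q : ℝ) ^ (D + 1)) / p) / (p : ℝ) ^ D
              + (q : ℝ) / 2 * ∑ j ∈ range D, ((q : ℝ) / p) ^ j := by gcongr
        _ = |(M : ℝ)| / (p : ℝ) ^ (D + 1) + (q : ℝ) / 2 * ∑ j ∈ range (D + 1), ((q : ℝ) / p) ^ j := by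
              rw [Finset.sum_range_succ, pow_succ, div_pow]
              field_simp
              ring

/-- **Lemma T, coefficient form.** For coprime `0 < q < p` and all `D`, `M` there is
`c ∈ ℤ^{D+1}` with `Σ cᵢ pⁱ q^{D−i} = M`, `2|cᵢ| ≤ p` for `i < D` and
`|c_D| ≤ |M|/p^D + qp/(2(p − q))` — a height bound independent of `D`. -/
theorem coprime_companion (p q : ℕ) (hq : 0 < q) (hqp : q < p) (hcop : Nat.Coprime p q)
    (D : ℕ) (M : ℤ) :
    ∃ c : Fin (D + 1) → ℤ,
      (∑ i, c i * (p : ℤ) ^ (i : ℕ) * (q : ℤ) ^ (D - i) = M) ∧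
      (∀ i : Fin (D + 1), (i : ℕ) < D → 2 * |c i| ≤ (p : ℤ)) ∧
      |(c (Fin.last D) : ℝ)| ≤ |(M : ℝ)| / (p : ℝ) ^ D + (q : ℝ) * p / (2 * ((p : ℝ) - q)) := by
  obtain ⟨c, hsum, hbnd, hlast⟩ := coprime_companion_aux p q hq hqp hcop D M
  refine ⟨c, hsum, hbnd, hlast.trans ?_⟩
  have hpR : (0 : ℝ) < p := by exact_mod_cast lt_trans hq hqp
  have hqR : (0 : ℝ) < q := by exact_mod_cast hq
  have hqpR : (q : ℝ) < p := by exact_mod_cast hqp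
  have hr0 : (0 : ℝ) ≤ (q : ℝ) / p := by positivity
  have hr1 : (q : ℝ) / p < 1 := (div_lt_one hpR).mpr hqpR
  have hgeom : ∑ j ∈ range D, ((q : ℝ) / p) ^ j ≤ (p : ℝ) / ((p : ℝ) - q) := by
    rw [geom_sum_eq hr1.ne D]
    have hden : (q : ℝ) / p - 1 < 0 := by linarith
    rw [div_le_iff_of_neg hden]
    have hpow : (0 : ℝ) ≤ ((q : ℝ) / p) ^ D := pow_nonneg hr0 D
    have hne : (p : ℝ) - q ≠ 0 := ne_of_gt (by linarith)
    have e : (p : ℝ) / ((p : ℝ) - q) * ((q : ℝ) / p - 1) = -1 := by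
      rw [div_mul_eq_mul_div, div_eq_iff hne, mul_sub, mul_one, mul_div_cancel₀ _ hpR.ne']
      ring
    rw [e]
    linarith
  have : (q : ℝ) / 2 * ∑ j ∈ range D, ((q : ℝ) / p) ^ j ≤ (q : ℝ) * p / (2 * ((p : ℝ) - q)) := by
    calc (q : ℝ) / 2 * ∑ j ∈ range D, ((q : ℝ) / p) ^ j ≤ (q : ℝ) / 2 * ((p : ℝ) / ((p : ℝ) - q)) := by
          gcongr
      _ = (q : ℝ) * p / (2 * ((p : ℝ) - q)) := by
          field_simp
  linarith

/-- **Lemma T, height form.** For coprime `p, q` with `3q < 2p < 4q` (`p/q ∈ (3/2, 2)`) and every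
`D` there is `c ∈ ℤ^{D+1}` with `Σ cᵢ pⁱ q^{D−i} = 1` and `2|cᵢ| ≤ 3q + 2` for all `i`, i.e. the
polynomial `T = Σ cᵢ Xⁱ` has `q^D T(p/q) = 1` and height `≤ 3q/2 + 1`. -/
theorem coprime_companion_height (p q : ℕ) (hq : 0 < q) (h32 : 3 * q < 2 * p) (h2 : p < 2 * q)
    (hcop : Nat.Coprime p q) (D : ℕ) :
    ∃ c : Fin (D + 1) → ℤ,
      (∑ i, c i * (p : ℤ) ^ (i : ℕ) * (q : ℤ) ^ (D - i) = 1) ∧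
      ∀ i : Fin (D + 1), 2 * |c i| ≤ 3 * (q : ℤ) + 2 := by
  have hqp : q < p := by omega
  obtain ⟨c, hsum, hbnd, hlast⟩ := coprime_companion p q hq hqp hcop D 1
  refine ⟨c, hsum, fun i => ?_⟩
  by_cases hi : (i : ℕ) < D
  · have := hbnd i hi
    have : (p : ℤ) < 2 * q := by exact_mod_cast h2
    linarith
  · have hiD : i = Fin.last D := by
      ext
      have := i.is_lt
      simp only [Fin.val_last]
      omega
    subst hiD
    have hpR : (1 : ℝ) ≤ p := by exact_mod_cast (by omega : 1 ≤ p)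
    have hqR : (0 : ℝ) < q := by exact_mod_cast hq
    have h32R : 3 * (q : ℝ) < 2 * p := by exact_mod_cast h32
    have hpq : (0 : ℝ) < (p : ℝ) - q := by linarith
    have h1 : |((1 : ℤ) : ℝ)| / (p : ℝ) ^ D ≤ 1 := by
      rw [Int.cast_one, abs_one]
      exact div_le_one_of_le₀ (one_le_pow₀ hpR) (by positivity)
    have h2' : (q : ℝ) * p / (2 * ((p : ℝ) - q)) < 3 * (q : ℝ) / 2 := by
      rw [div_lt_div_iff₀ (by positivity) (by norm_num : (0 : ℝ) < 2)]
      nlinarith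
    have hR : |(c (Fin.last D) : ℝ)| < 3 * (q : ℝ) / 2 + 1 := by linarith
    have hZ : (2 : ℝ) * |(c (Fin.last D) : ℝ)| < 3 * (q : ℝ) + 2 := by linarith
    have hZ' : ((2 * |c (Fin.last D)| : ℤ) : ℝ) < ((3 * (q : ℤ) + 2 : ℤ) : ℝ) := by
      push_cast
      exact hZ
    have := Int.cast_lt.mp hZ'
    omega

/-- **`q^D · T(p/q) = Σ cᵢ pⁱ q^{D−i}`**: the coefficient identity is the statement
`T(p/q) = M q^{−D}` for `T = Σ_{i ≤ D} cᵢ Xⁱ`; in particular with `M = 1`, `T(p/q) ≠ 0`, so `T` is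
coprime to `qX − p`. -/
theorem coprime_companion_eval (p q : ℕ) (hq : 0 < q) (D : ℕ) (c : Fin (D + 1) → ℤ) :
    (q : ℚ) ^ D * ∑ i, (c i : ℚ) * ((p : ℚ) / q) ^ (i : ℕ) =
      ((∑ i, c i * (p : ℤ) ^ (i : ℕ) * (q : ℤ) ^ (D - i) : ℤ) : ℚ) := by
  have hq0 : (q : ℚ) ≠ 0 := by exact_mod_cast hq.ne'
  push_cast
  rw [Finset.mul_sum]
  refine Finset.sum_congr rfl fun i _ => ?_
  have hi : (i : ℕ) ≤ D := Nat.lt_succ_iff.mp i.is_lt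
  rw [div_pow]
  have e : (q : ℚ) ^ D = (q : ℚ) ^ (i : ℕ) * (q : ℚ) ^ (D - i) := by
    rw [← pow_add, Nat.add_sub_cancel' hi]
  rw [e]
  field_simp

end Summit.Schanuel.Schanuel.Theorems
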